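import Summits.KontsevichZagierPeriods.KontsevichZagierPeriods.Theses.HurwitzMicroSectors
import Summits.KontsevichZagierPeriods.KontsevichZagierPeriods.Theorems.HurwitzMicroSectorsNormalFormPrinciplePiBoxTransfer
import Summits.KontsevichZagierPeriods.KontsevichZagierPeriods.Theorems.HurwitzMicroSectorsNormalFormPrincipleVariants2341

/-! TTRL-lite variant V2353 of stmt-KontsevichZagierPeriods-3869

Variant V2353 = `stub_boxRigidity` (BoxRigidity: two box-rational representations — domain the open
unit box, integrand `p/q` over `ℚ` — with equal values are KZ-equivalent) under the two-sided
small-case move `fix_nat:m'=3; bound_nat:m≤4` (right dimension frozen to `3`, left dimension `m ≤ 4`).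
Verdict of the attempt seat: **open** — this file is the exact-strength certificate, not a proof of
the variant. Freezing `m' = 3` next to `m ≤ 4` is idle: V2353 is EQUIVALENT to
**BoxVanishing in dimension `≤ 4`** — every box-rational representation on `(0,1)^m`, `m ≤ 4`, of
value `0` is a Kontsevich–Zagier relation (`stub_boxRigidity_var2353_iff_boxVanishingLe_four`: `⇒`
compare with the zero representation on the `3`-box; `⇐` pad both sides to the common box by unit
intervals, `pad_le`, subtract on the common box, `sub_same`, value `0` by soundness —
the rung `K = 4` `boxRigidityLe_of_boxVanishingLe_four` of file `…Variants2341`, imported), equivalently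
to BoxRigidity with BOTH dimensions `≤ 4`
(`stub_boxRigidity_var2353_iff_boxRigidityLe_four`) — so V2353 is the SAME statement as the
recorded-open sibling V2341 (`m' = 2`, `m ≤ 4`), both being BoxVanishing(dim `≤ 4`)
(`stub_boxRigidity_var2353_iff_var2341`). Hence V2353 implies every jointly bounded
sibling with `max j k ≤ 4` (`boxRigidityLe_of_stub_boxRigidity_var2353`), in particular the
recorded-open variants V2338 (`m, m' ≤ 2` = BoxVanishing in dimension `2`: Catalan's `G` against
`ℚ + ℚπ² + ℚ log 2`), V2349/V2351 (`= BoxVanishing(3)`: `ζ(3) ∈ ℚ + ℚπ²`?); and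
`KontsevichZagierPeriods → V2353` (`stub_boxRigidity_var2353_of_statement`), so a refutation of the
variant would refute Conjecture 1 for the tree's calculus. The proved two-sided frontier stays
`max j k ≤ 1` (`boxRigidity_of_le_one`, Baker); no slice of V2353 with the frozen `m' = 3` is below it
(already `m = 0` against `(0,1)³` is BoxVanishing in dimension `3`,
`boxVanishing_three_of_stub_boxRigidity_var2353`).
Source: M. Kontsevich, D. Zagier, *Periods* (2001), §1.2 Conjecture 1 and rules 1)–3).
Pure proof file, no definitions. -/

-- `Summit.<Summit>.<Problem>` is the tree's mandated summit-side namespace (CONVENTIONS §2); for this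
-- single-conjunct summit the two coincide, so the duplicate is deliberate.
set_option linter.dupNamespace false

noncomputable section

namespace Summit.KontsevichZagierPeriods.KontsevichZagierPeriods.Theorems

open MeasureTheory Set
open Literature.NumberTheory.Transcendental Literature.NumberTheory.Transcendental.KZ
open Summit.KontsevichZagierPeriods.KontsevichZagierPeriods.Theses.HurwitzMicroSectors
open Summit.KontsevichZagierPeriods.HurwitzMicroSectors.NormalFormPrinciple.PiBox

/-! ## V2353 ⇒ BoxVanishing in dimension `≤ 4` -/

/-- **V2353 ⇒ BoxVanishing(dim ≤ 4)**: compare a box-rational `N : IntegralRep m`, `m ≤ 4`, of value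
`0` with the zero representation on the `3`-box (box-rational, value `0`, itself a relation).
[cite: KontsevichZagier2001, §1.2 Conjecture 1] -/
theorem boxVanishingLe_four_of_stub_boxRigidity_var2353
    (h : ∀ (m : ℕ) (N : IntegralRep m) (N' : IntegralRep 3), m ≤ 4 → N.domain = {x | ∀ i, x i ∈ Set.Ioo (0:ℝ) 1} → N.IsRational → N'.domain = {x | ∀ i, x i ∈ Set.Ioo (0:ℝ) 1} → N'.IsRational → N.value = N'.value → Equivalent N N') :
    ∀ (m : ℕ) (N : IntegralRep m), m ≤ 4 → N.domain = {x | ∀ i, x i ∈ Set.Ioo (0:ℝ) 1} →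
      N.IsRational → N.value = 0 → of N ∈ relations := by
  intro m N hm hNd hNr hv
  obtain ⟨Z, hZd, hZi⟩ := exists_zeroRep (isSemialgebraic_box 3)
  have hZ : of Z ∈ relations := of_mem_relations_of_eqOn_zero Z (by simp [hZi, EqOn])
  have hZv : Z.value = 0 := by simp [IntegralRep.value, hZi]
  have hZr : Z.IsRational := ⟨0, 1, fun x _ => by simp, fun x _ => by simp [hZi]⟩
  have h' : of N - of Z ∈ relations := h m N Z hm hNd hNr hZd hZr (by rw [hv, hZv])
  have := relations.add_mem h' hZ
  rwa [sub_add_cancel] at this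

/-- **V2353 ⇒ BoxVanishing in dimension `3`** (already the slice `m = 0` of the variant: the frozen
side `(0,1)³` carries Conjecture 1 for all rational integrands over `ℚ` on the cube — e.g. the
`ζ(3)`/`π²` layer, cf. `…Variants2349`). [cite: KontsevichZagier2001, §1.2 Conjecture 1] -/
theorem boxVanishing_three_of_stub_boxRigidity_var2353
    (h : ∀ (m : ℕ) (N : IntegralRep m) (N' : IntegralRep 3), m ≤ 4 → N.domain = {x | ∀ i, x i ∈ Set.Ioo (0:ℝ) 1} → N.IsRational → N'.domain = {x | ∀ i, x i ∈ Set.Ioo (0:ℝ) 1} → N'.IsRational → N.value = N'.value → Equivalent N N')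
    (N : IntegralRep 3) (hNd : N.domain = {x | ∀ i, x i ∈ Set.Ioo (0:ℝ) 1}) (hNr : N.IsRational)
    (hv : N.value = 0) : of N ∈ relations := by
  obtain ⟨Z, hZd, hZi⟩ := exists_zeroRep (isSemialgebraic_box 0)
  have hZ : of Z ∈ relations := of_mem_relations_of_eqOn_zero Z (by simp [hZi, EqOn])
  have hZv : Z.value = 0 := by simp [IntegralRep.value, hZi]
  have hZr : Z.IsRational := ⟨0, 1, fun x _ => by simp, fun x _ => by simp [hZi]⟩
  have h' : of Z - of N ∈ relations := h 0 Z N (Nat.zero_le 4) hZd hZr hNd hNr (by rw [hv, hZv])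
  have := relations.sub_mem hZ h'
  rwa [sub_sub_cancel] at this

/-! ## BoxVanishing in dimension `≤ 4` ⇒ V2353 -/

/-- **BoxVanishing(dim ≤ 4) ⇒ V2353**: pad both representations to the common box by unit intervals
(`pad_le`), subtract on the common box (`sub_same`, rule 1b)); the difference has value `0` by
soundness, hence is a relation (instance `j = 4, k = 3` of `boxRigidityLe_of_boxVanishingLe_four`).
[cite: KontsevichZagier2001, §1.2 Conjecture 1] -/
theorem stub_boxRigidity_var2353_of_boxVanishingLe_four
    (hvan : ∀ (m : ℕ) (N : IntegralRep m), m ≤ 4 → N.domain = {x | ∀ i, x i ∈ Set.Ioo (0:ℝ) 1} →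
      N.IsRational → N.value = 0 → of N ∈ relations) :
    ∀ (m : ℕ) (N : IntegralRep m) (N' : IntegralRep 3), m ≤ 4 → N.domain = {x | ∀ i, x i ∈ Set.Ioo (0:ℝ) 1} → N.IsRational → N'.domain = {x | ∀ i, x i ∈ Set.Ioo (0:ℝ) 1} → N'.IsRational → N.value = N'.value → Equivalent N N' :=
  fun m N N' hm => boxRigidityLe_of_boxVanishingLe_four 4 3 (by norm_num) hvan m 3 N N' hm (by norm_num)

/-! ## The variant V2353 itself: exact strength -/

/-- **V2353 ⟺ BoxVanishing(dim ≤ 4)**: the variant is exactly "every rational function over `ℚ` on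
`(0,1)^m`, `m ≤ 4`, absolutely integrable with integral `0`, is a KZ relation" — Conjecture 1 for all
box-rational periods of dimension `≤ 4`, open. [cite: KontsevichZagier2001, §1.2 Conjecture 1] -/
theorem stub_boxRigidity_var2353_iff_boxVanishingLe_four :
    (∀ (m : ℕ) (N : IntegralRep m) (N' : IntegralRep 3), m ≤ 4 → N.domain = {x | ∀ i, x i ∈ Set.Ioo (0:ℝ) 1} → N.IsRational → N'.domain = {x | ∀ i, x i ∈ Set.Ioo (0:ℝ) 1} → N'.IsRational → N.value = N'.value → Equivalent N N') ↔
    (∀ (m : ℕ) (N : IntegralRep m), m ≤ 4 → N.domain = {x | ∀ i, x i ∈ Set.Ioo (0:ℝ) 1} →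
      N.IsRational → N.value = 0 → of N ∈ relations) :=
  ⟨boxVanishingLe_four_of_stub_boxRigidity_var2353, stub_boxRigidity_var2353_of_boxVanishingLe_four⟩

/-- **V2353 ⟺ BoxRigidity with both dimensions `≤ 4`**: the frozen `m' = 3` is idle next to `m ≤ 4`
(the honest strength of the variant: Conjecture 1 for all pairs of rational integrands over `ℚ` on the
open unit boxes of dimension at most `4`). [cite: KontsevichZagier2001, §1.2 Conjecture 1] -/
theorem stub_boxRigidity_var2353_iff_boxRigidityLe_four :
    (∀ (m : ℕ) (N : IntegralRep m) (N' : IntegralRep 3), m ≤ 4 → N.domain = {x | ∀ i, x i ∈ Set.Ioo (0:ℝ) 1} → N.IsRational → N'.domain = {x | ∀ i, x i ∈ Set.Ioo (0:ℝ) 1} → N'.IsRational → N.value = N'.value → Equivalent N N') ↔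
    (∀ (m m' : ℕ) (N : IntegralRep m) (N' : IntegralRep m'), m ≤ 4 → m' ≤ 4 →
      N.domain = {x | ∀ i, x i ∈ Set.Ioo (0:ℝ) 1} → N.IsRational →
      N'.domain = {x | ∀ i, x i ∈ Set.Ioo (0:ℝ) 1} → N'.IsRational →
      N.value = N'.value → Equivalent N N') :=
  ⟨fun h => boxRigidityLe_of_boxVanishingLe_four 4 4 (by norm_num)
      (boxVanishingLe_four_of_stub_boxRigidity_var2353 h),
    fun h m N N' hm => h m 3 N N' hm (by norm_num)⟩

/-- **V2353 ⟺ V2341**: freezing the right dimension to `3` (`m ≤ 4`) or to `2` (`m ≤ 4`) gives the same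
statement, BoxVanishing(dim `≤ 4`) (`stub_boxRigidity_var2341_iff_boxVanishingLe_four`, file
`…Variants2341`). [cite: KontsevichZagier2001, §1.2 Conjecture 1] -/
theorem stub_boxRigidity_var2353_iff_var2341 :
    (∀ (m : ℕ) (N : IntegralRep m) (N' : IntegralRep 3), m ≤ 4 → N.domain = {x | ∀ i, x i ∈ Set.Ioo (0:ℝ) 1} → N.IsRational → N'.domain = {x | ∀ i, x i ∈ Set.Ioo (0:ℝ) 1} → N'.IsRational → N.value = N'.value → Equivalent N N') ↔
    (∀ (m : ℕ) (N : IntegralRep m) (N' : IntegralRep 2), m ≤ 4 → N.domain = {x | ∀ i, x i ∈ Set.Ioo (0:ℝ) 1} → N.IsRational → N'.domain = {x | ∀ i, x i ∈ Set.Ioo (0:ℝ) 1} → N'.IsRational → N.value = N'.value → Equivalent N N') :=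
  stub_boxRigidity_var2353_iff_boxVanishingLe_four.trans stub_boxRigidity_var2341_iff_boxVanishingLe_four.symm

/-- **Monotonicity in the rung**: BoxVanishing(dim `≤ 5`) ⇒ V2353 (so the sibling V2343 = rung `5`
implies V2353 = rung `4`). [cite: KontsevichZagier2001, §1.2 Conjecture 1] -/
theorem stub_boxRigidity_var2353_of_boxVanishingLe_five
    (hvan : ∀ (m : ℕ) (N : IntegralRep m), m ≤ 5 → N.domain = {x | ∀ i, x i ∈ Set.Ioo (0:ℝ) 1} →
      N.IsRational → N.value = 0 → of N ∈ relations) :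
    ∀ (m : ℕ) (N : IntegralRep m) (N' : IntegralRep 3), m ≤ 4 → N.domain = {x | ∀ i, x i ∈ Set.Ioo (0:ℝ) 1} → N.IsRational → N'.domain = {x | ∀ i, x i ∈ Set.Ioo (0:ℝ) 1} → N'.IsRational → N.value = N'.value → Equivalent N N' :=
  stub_boxRigidity_var2353_of_boxVanishingLe_four fun m N hm => hvan m N (hm.trans (by norm_num))

/-- **V2353 dominates every jointly bounded sibling with `max j k ≤ 4`**: V2353 ⇒
`BoxRigidity(m ≤ j, m' ≤ k)` whenever `max j k ≤ 4` — in particular the recorded-open variants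
V2338 (`j = k = 2`), V2340 (`j = 3, k = 2`), V2349/V2351 (`k = 3`); so V2353 is open a fortiori.
[cite: KontsevichZagier2001, §1.2 Conjecture 1] -/
theorem boxRigidityLe_of_stub_boxRigidity_var2353 (j k : ℕ) (hjk : max j k ≤ 4)
    (h : ∀ (m : ℕ) (N : IntegralRep m) (N' : IntegralRep 3), m ≤ 4 → N.domain = {x | ∀ i, x i ∈ Set.Ioo (0:ℝ) 1} → N.IsRational → N'.domain = {x | ∀ i, x i ∈ Set.Ioo (0:ℝ) 1} → N'.IsRational → N.value = N'.value → Equivalent N N') :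
    ∀ (m m' : ℕ) (N : IntegralRep m) (N' : IntegralRep m'), m ≤ j → m' ≤ k →
      N.domain = {x | ∀ i, x i ∈ Set.Ioo (0:ℝ) 1} → N.IsRational →
      N'.domain = {x | ∀ i, x i ∈ Set.Ioo (0:ℝ) 1} → N'.IsRational →
      N.value = N'.value → Equivalent N N' :=
  boxRigidityLe_of_boxVanishingLe_four j k hjk (boxVanishingLe_four_of_stub_boxRigidity_var2353 h)

/-- **Any frozen right dimension `m' ≤ 4` is the same variant**: V2353 ⇒ the sibling with the right
dimension frozen to any `m' ≤ 4` and `m ≤ j ≤ 4` (e.g. V2351: `m' = 3`, `m ≤ 3`).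
[cite: KontsevichZagier2001, §1.2 Conjecture 1] -/
theorem boxRigidityFix_of_stub_boxRigidity_var2353 (j m' : ℕ) (hj : j ≤ 4) (hm' : m' ≤ 4)
    (h : ∀ (m : ℕ) (N : IntegralRep m) (N' : IntegralRep 3), m ≤ 4 → N.domain = {x | ∀ i, x i ∈ Set.Ioo (0:ℝ) 1} → N.IsRational → N'.domain = {x | ∀ i, x i ∈ Set.Ioo (0:ℝ) 1} → N'.IsRational → N.value = N'.value → Equivalent N N') :
    ∀ (m : ℕ) (N : IntegralRep m) (N' : IntegralRep m'), m ≤ j →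
      N.domain = {x | ∀ i, x i ∈ Set.Ioo (0:ℝ) 1} → N.IsRational →
      N'.domain = {x | ∀ i, x i ∈ Set.Ioo (0:ℝ) 1} → N'.IsRational →
      N.value = N'.value → Equivalent N N' :=
  fun m N N' hm => boxRigidityLe_of_stub_boxRigidity_var2353 4 4 (by norm_num) h m m' N N'
    (hm.trans hj) hm'

/-! ## The other side: the variant is implied by the Summit -/

/-- **The parent leaf ⇒ V2353** (specialisation `m' := 3`; the converse is not claimed — the parent
is BoxVanishing in ALL dimensions). [cite: KontsevichZagier2001, §1.2 Conjecture 1] -/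
theorem stub_boxRigidity_var2353_of_parent
    (h : ∀ (m m' : ℕ) (N : IntegralRep m) (N' : IntegralRep m'), N.domain = {x | ∀ i, x i ∈ Set.Ioo (0:ℝ) 1} → N.IsRational → N'.domain = {x | ∀ i, x i ∈ Set.Ioo (0:ℝ) 1} → N'.IsRational → N.value = N'.value → Equivalent N N') :
    ∀ (m : ℕ) (N : IntegralRep m) (N' : IntegralRep 3), m ≤ 4 → N.domain = {x | ∀ i, x i ∈ Set.Ioo (0:ℝ) 1} → N.IsRational → N'.domain = {x | ∀ i, x i ∈ Set.Ioo (0:ℝ) 1} → N'.IsRational → N.value = N'.value → Equivalent N N' :=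
  fun m N N' _ => h m 3 N N'

/-- **`KontsevichZagierPeriods ⇒ V2353`**: the variant is a special case of Conjecture 1 for the
tree's calculus (`leaves_of_statement`) — a refutation of the variant would refute the Summit.
[cite: KontsevichZagier2001, §1.2 Conjecture 1] -/
theorem stub_boxRigidity_var2353_of_statement (h : _root_.KontsevichZagierPeriods) :
    ∀ (m : ℕ) (N : IntegralRep m) (N' : IntegralRep 3), m ≤ 4 → N.domain = {x | ∀ i, x i ∈ Set.Ioo (0:ℝ) 1} → N.IsRational → N'.domain = {x | ∀ i, x i ∈ Set.Ioo (0:ℝ) 1} → N'.IsRational → N.value = N'.value → Equivalent N N' :=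
  stub_boxRigidity_var2353_of_parent (leaves_of_statement h).1

end Summit.KontsevichZagierPeriods.KontsevichZagierPeriods.Theorems
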